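import Summits.CriticalPhenomena.PercolationContinuityZ3.Theorems.PercNearOneGluingNoHeavyLowerTailThreePointIsoAsymFace
import Summits.CriticalPhenomena.PercolationContinuityZ3.Theorems.PercNearOneGluingNoHeavyLowerTailSuperTerminalP3LamAFreePendant
import Summits.CriticalPhenomena.PercolationContinuityZ3.Theorems.PercNearOneGluingNoHeavyLowerTailSuperTerminalP3LamPortPiecesFour
import HarnessLib

/-!
# Pieces missing `a` or `s` are irrelevant to `P3_λ` (λ ≥ 3/2) UNCONDITIONALLY: the gluing criterion holds for every real piece

Support file for crux `stmt-CriticalPhenomena-4575` (`NoHeavyLowerTail`), seat `prim-l12-p1` gen 34 (`--supports stmt-CriticalPhenomena-4575`);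
memo `run/shared/lean/prim/prim-l12/FROM-prim-l12-p1-g34-LV-CONE-ASYM-ISOLATION.md`.  No definitions, no sorries, standard axioms; unconditional.

`…SuperTerminalP3LamPortPiecesFour.p3lam_of_portPieces₄` (prim-l12-p1 gen 33) reduces the row `P3_λ` (every `λ ≥ 3/2`, the sharp row
`λ = 3/2` included) to the pieces touching the port `c`, `b`, and BOTH `s` and `a` — CONDITIONALLY on the gluing criterion `C(γ) ∀γ ∈ [0,1]`
for the pieces missing `a` or `s` (CONJECTURE AF of the gen-33 memo).  Here the condition is DISCHARGED:
* `afOne_lam_graph` — the pendant form `AF¹_λ(γ)` (both quadratics) holds for EVERY finite weighted 3-terminal graph, every `λ ≥ 3/2` and every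
  `γ ≥ 0`: it is the member `σ = λ/(λ−1+γ)` of the generalised face inequalities `ThreePointIsoAsymFace.faceAsym_graph` (asymmetric isolation laws
  `…ThreePointIsoAsymUniversal`), via the exact identity `M·AF¹_τ = λ²E·t + λLE·u + λγ·D̃` (`L = λ−1+γ`, `M = λL(L+λ)`,
  `E = L²(L+λ) − γ(L²+λL+λ²) = (λ−1)(L²+λ²) − λL ≥ 0` for `λ ≥ 3/2`, `D̃ ≥ 0` the cleared face inequality);
* `pcrit_of_aFree`, `pcrit_of_sFree` — hence the criterion `C(γ)` of `…SuperTerminalP3LamAFreePieces` holds for every piece weight missing `a`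
  (resp. `s`), all `γ ∈ [0,1]` (`SuperTerminalP3LamAFreePendant.crit_of_afOne`);
* `p3lam_of_portPieces₅` — **MAIN THEOREM: for `λ ≥ 3/2`, every `{s,a,b,c}`-piece that misses the port, or misses `b`, or misses `s`, or misses
  `a`, is irrelevant to `P3_λ`: if the partial union over the remaining pieces satisfies the row, so does `w`.**  Consequently a counterexample to
  the sharp row `P3_{3/2}` with the fewest active vertices is a union of `{s,a,b,c}`-pieces EACH TOUCHING ALL FOUR TERMINALS (with no pair inside
  `{s,a,b,c}` and `G ∖ {s,a,b}` connected: `…PortPart`, `…PortComponent`).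
-/

namespace Summit.CriticalPhenomena.PercolationContinuityZ3.Theorems.SuperTerminalP3LamPortPiecesFive

open MeasureTheory Set Filter
open Literature.Probability.Percolation Literature.Probability.Percolation.PartitionGluing
open Literature.Probability.LatticeModels (prodBernoulli)
open SuperTerminalDownsets
open SuperTerminalP3LamPortPiecesTwo (real_congr_of_ae ae_sep_of_isolated)
open SuperTerminalP3LamAFreePendant (crit_of_afOne)
open ThreePointIsoAsymFace (faceAsym_graph)
open scoped Classical

variable {V : Type*} [Fintype V]

/-- The gluing criterion `C(γ)` of an `a`-free / `s`-free piece in terms of four down-set coordinates (as in `…AFreePendant`).  Local notation only. -/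
local notation "Crit[" lam ";" g ";" n "," N2 "," N4 "," ic "]" =>
  (((lam - 1 + g) * (n * (1 - g * ic) - (lam - 1 + g * ic) * (N2 + N4 - 2 * n)) ≤ (1 - g) * (lam - 1 + g * ic) * N2 ∧
      (lam - 1 + g) * (n * (1 - g * ic) - (lam - 1 + g * ic) * (N2 + N4 - 2 * n)) ≤ (1 - g) * (lam - 1 + g * ic) * N4) : Prop)

/-- The pendant form `AF¹_λ(γ; N₀, t, u, k)` (both versions, as in `…AFreePendant`).  Local notation only. -/
local notation "AFone[" lam ";" g ";" N0 "," t "," u "," k "]" =>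
  ((0 ≤ (lam - 1) * ((lam - 1) * (t + u) + t) + g * (2 * (lam - 1) * (t + u) + (1 - (lam - 1)) * t - lam * N0 * k) + g ^ 2 * u ∧
      0 ≤ (lam - 1) * ((lam - 1) * (t + u) + u) + g * (2 * (lam - 1) * (t + u) + (1 - (lam - 1)) * u - lam * N0 * k) + g ^ 2 * t) : Prop)

/-! ## `AF¹_λ` for every 3-terminal weighted graph -/

section Three

/-- **`AF¹_λ(γ)` on every finite weighted graph** (terminals `a, b`, port `c`; `λ ≥ 3/2`, `γ ≥ 0`): with `Q = μ(a|b|c)`, `I_a = μ(a↮{b,c})`,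
`I_b = μ(b↮{a,c})`, `I_c = μ(c↮{a,b})`, `N₀ = I_a + I_b − Q`, `t = I_b − Q`, `u = I_a − Q`, `k = 1 − I_c`, both quadratics of
`AFone[λ; γ; N₀, t, u, k]` are nonnegative.  Member `σ = λ/(λ−1+γ)` of `faceAsym_graph`. [this work] -/
theorem afOne_lam_graph {lam : ℝ} (hlam : 3 / 2 ≤ lam) (w : Sym2 V → unitInterval) (a b c : V) {g : ℝ} (hg : 0 ≤ g) :
    AFone[lam; g;
      (prodBernoulli w).real ((openConn a b)ᶜ ∩ (openConn a c)ᶜ) + (prodBernoulli w).real ((openConn a b)ᶜ ∩ (openConn b c)ᶜ)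
        - (prodBernoulli w).real ((openConn a b)ᶜ ∩ (openConn a c)ᶜ ∩ (openConn b c)ᶜ),
      (prodBernoulli w).real ((openConn a b)ᶜ ∩ (openConn b c)ᶜ) - (prodBernoulli w).real ((openConn a b)ᶜ ∩ (openConn a c)ᶜ ∩ (openConn b c)ᶜ),
      (prodBernoulli w).real ((openConn a b)ᶜ ∩ (openConn a c)ᶜ) - (prodBernoulli w).real ((openConn a b)ᶜ ∩ (openConn a c)ᶜ ∩ (openConn b c)ᶜ),
      1 - (prodBernoulli w).real ((openConn a c)ᶜ ∩ (openConn b c)ᶜ)] := by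
  set μ := prodBernoulli w with hμ
  set Q := μ.real ((openConn a b)ᶜ ∩ (openConn a c)ᶜ ∩ (openConn b c)ᶜ) with hQ
  set IA := μ.real ((openConn a b)ᶜ ∩ (openConn a c)ᶜ) with hIA
  set IB := μ.real ((openConn a b)ᶜ ∩ (openConn b c)ᶜ) with hIB
  set IC := μ.real ((openConn a c)ᶜ ∩ (openConn b c)ᶜ) with hIC
  have hQA : Q ≤ IA := measureReal_mono (fun ω hω => hω.1)
  have hQB : Q ≤ IB := measureReal_mono (fun ω hω => ⟨hω.1.1, hω.2⟩)
  have ht0 : 0 ≤ IB - Q := sub_nonneg.2 hQB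
  have hu0 : 0 ≤ IA - Q := sub_nonneg.2 hQA
  -- the admissible pair for `σ = λ/L`, `L = λ − 1 + γ`: `p = L·A/M`, `q = λ·A/M`, `A = L² + λL + λ²`, `M = λL(L+λ)`
  set L : ℝ := lam - 1 + g with hL
  set A : ℝ := L ^ 2 + lam * L + lam ^ 2 with hA
  set M : ℝ := lam * L * (L + lam) with hM
  clear_value L A M
  have hlam0 : 0 < lam := by linarith
  have hLpos : 0 < L := by rw [hL]; linarith
  have hApos : 0 < A := by rw [hA]; positivity
  have hMpos : 0 < M := by rw [hM]; positivity
  have adm : ∀ {P' Q' : ℝ}, M ≤ P' → M ≤ Q' → P' * Q' * (P' + Q') = M * (P' ^ 2 + P' * Q' + Q' ^ 2) →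
      1 ≤ P' / M ∧ 1 ≤ Q' / M ∧ (P' / M) ^ 2 + P' / M * (Q' / M) + (Q' / M) ^ 2 ≤ P' / M * (Q' / M) * (P' / M + Q' / M) := by
    intro P' Q' hP hQ' hcurve
    refine ⟨(one_le_div hMpos).2 hP, (one_le_div hMpos).2 hQ', ?_⟩
    have hM0 : M ≠ 0 := hMpos.ne'
    have key : P' / M * (Q' / M) * (P' / M + Q' / M) - ((P' / M) ^ 2 + P' / M * (Q' / M) + (Q' / M) ^ 2) =
        (P' * Q' * (P' + Q') - M * (P' ^ 2 + P' * Q' + Q' ^ 2)) / M ^ 3 := by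
      field_simp
    rw [hcurve, sub_self, zero_div] at key
    linarith
  have hP1 : M ≤ L * A := by
    rw [hM, hA]; nlinarith [mul_pos hLpos (mul_pos hLpos hLpos), sq_nonneg L]
  have hQ1 : M ≤ lam * A := by
    rw [hM, hA]; nlinarith [mul_pos hlam0 (mul_pos hlam0 hlam0)]
  have hcurve : L * A * (lam * A) * (L * A + lam * A) = M * ((L * A) ^ 2 + L * A * (lam * A) + (lam * A) ^ 2) := by
    rw [hM, hA]; ring
  have hcurve' : lam * A * (L * A) * (lam * A + L * A) = M * ((lam * A) ^ 2 + lam * A * (L * A) + (L * A) ^ 2) := by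
    rw [hM, hA]; ring
  obtain ⟨hp, hq, hpq⟩ := adm hP1 hQ1 hcurve
  obtain ⟨hp', hq', hpq'⟩ := adm hQ1 hP1 hcurve'
  have F1 := faceAsym_graph hp hq hpq w a b c
  have F2 := faceAsym_graph hp' hq' hpq' w a b c
  rw [← hμ] at F1 F2
  change (IA + IB - Q) * (1 - IC) ≤ lam * A / M * (IB - Q) + L * A / M * (IA - Q) at F1
  change (IA + IB - Q) * (1 - IC) ≤ L * A / M * (IB - Q) + lam * A / M * (IA - Q) at F2
  have hM0 : M ≠ 0 := hMpos.ne'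
  have D1 : M * ((IA + IB - Q) * (1 - IC)) ≤ lam * A * (IB - Q) + L * A * (IA - Q) := by
    have h := mul_le_mul_of_nonneg_left F1 hMpos.le
    have e : M * (lam * A / M * (IB - Q) + L * A / M * (IA - Q)) = lam * A * (IB - Q) + L * A * (IA - Q) := by field_simp
    rwa [e] at h
  have D2 : M * ((IA + IB - Q) * (1 - IC)) ≤ L * A * (IB - Q) + lam * A * (IA - Q) := by
    have h := mul_le_mul_of_nonneg_left F2 hMpos.le
    have e : M * (L * A / M * (IB - Q) + lam * A / M * (IA - Q)) = L * A * (IB - Q) + lam * A * (IA - Q) := by field_simp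
    rwa [e] at h
  -- `E = L²(L+λ) − γA ≥ 0` for `λ ≥ 3/2`
  have hE : 0 ≤ L ^ 2 * (L + lam) - g * A := by
    have e1 : L ^ 2 * (L + lam) - g * A = (lam - 1) * (L ^ 2 + lam ^ 2) - lam * L := by
      have hg' : g = L - lam + 1 := by rw [hL]; ring
      rw [hg', hA]; ring
    have e2 : 4 * (lam - 1) * ((lam - 1) * (L ^ 2 + lam ^ 2) - lam * L) =
        (2 * (lam - 1) * L - lam) ^ 2 + lam ^ 2 * (4 * (lam - 1) ^ 2 - 1) := by ring
    have h4 : 0 ≤ 4 * (lam - 1) ^ 2 - 1 := by nlinarith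
    have hpos : 0 < 4 * (lam - 1) := by linarith
    have : 0 ≤ 4 * (lam - 1) * ((lam - 1) * (L ^ 2 + lam ^ 2) - lam * L) := by
      rw [e2]; positivity
    rw [e1]
    exact (mul_nonneg_iff_of_pos_left hpos).1 this
  constructor
  · have key : M * ((lam - 1) * ((lam - 1) * ((IB - Q) + (IA - Q)) + (IB - Q)) +
        g * (2 * (lam - 1) * ((IB - Q) + (IA - Q)) + (1 - (lam - 1)) * (IB - Q) - lam * (IA + IB - Q) * (1 - IC)) + g ^ 2 * (IA - Q)) =
        lam ^ 2 * (L ^ 2 * (L + lam) - g * A) * (IB - Q) + lam * L * (L ^ 2 * (L + lam) - g * A) * (IA - Q) +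
          lam * g * (lam * A * (IB - Q) + L * A * (IA - Q) - M * ((IA + IB - Q) * (1 - IC))) := by
      rw [hM, hA, hL]; ring
    have rhs : 0 ≤ lam ^ 2 * (L ^ 2 * (L + lam) - g * A) * (IB - Q) + lam * L * (L ^ 2 * (L + lam) - g * A) * (IA - Q) +
        lam * g * (lam * A * (IB - Q) + L * A * (IA - Q) - M * ((IA + IB - Q) * (1 - IC))) := by
      have h1 : 0 ≤ lam ^ 2 * (L ^ 2 * (L + lam) - g * A) * (IB - Q) := by positivity
      have h2 : 0 ≤ lam * L * (L ^ 2 * (L + lam) - g * A) * (IA - Q) :=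
        mul_nonneg (mul_nonneg (mul_nonneg hlam0.le hLpos.le) hE) hu0
      have h3 : 0 ≤ lam * g * (lam * A * (IB - Q) + L * A * (IA - Q) - M * ((IA + IB - Q) * (1 - IC))) :=
        mul_nonneg (mul_nonneg hlam0.le hg) (by linarith)
      linarith
    rw [← key] at rhs
    exact (mul_nonneg_iff_of_pos_left hMpos).1 rhs
  · have key : M * ((lam - 1) * ((lam - 1) * ((IB - Q) + (IA - Q)) + (IA - Q)) +
        g * (2 * (lam - 1) * ((IB - Q) + (IA - Q)) + (1 - (lam - 1)) * (IA - Q) - lam * (IA + IB - Q) * (1 - IC)) + g ^ 2 * (IB - Q)) =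
        lam ^ 2 * (L ^ 2 * (L + lam) - g * A) * (IA - Q) + lam * L * (L ^ 2 * (L + lam) - g * A) * (IB - Q) +
          lam * g * (L * A * (IB - Q) + lam * A * (IA - Q) - M * ((IA + IB - Q) * (1 - IC))) := by
      rw [hM, hA, hL]; ring
    have rhs : 0 ≤ lam ^ 2 * (L ^ 2 * (L + lam) - g * A) * (IA - Q) + lam * L * (L ^ 2 * (L + lam) - g * A) * (IB - Q) +
        lam * g * (L * A * (IB - Q) + lam * A * (IA - Q) - M * ((IA + IB - Q) * (1 - IC))) := by
      have h1 : 0 ≤ lam ^ 2 * (L ^ 2 * (L + lam) - g * A) * (IA - Q) := by positivity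
      have h2 : 0 ≤ lam * L * (L ^ 2 * (L + lam) - g * A) * (IB - Q) :=
        mul_nonneg (mul_nonneg (mul_nonneg hlam0.le hLpos.le) hE) ht0
      have h3 : 0 ≤ lam * g * (L * A * (IB - Q) + lam * A * (IA - Q) - M * ((IA + IB - Q) * (1 - IC))) :=
        mul_nonneg (mul_nonneg hlam0.le hg) (by linarith)
      linarith
    rw [← key] at rhs
    exact (mul_nonneg_iff_of_pos_left hMpos).1 rhs

end Three

/-! ## The criterion for every `a`-free / `s`-free piece -/

section Pieces
variable {s a b c : V}

/-- **The gluing criterion holds for every `a`-free piece.**  If the pairs of `u` avoid `a` (`s a b c` distinct), then for every `λ ≥ 3/2` and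
`γ ∈ [0,1]` the criterion `C(γ)` of `…SuperTerminalP3LamAFreePieces` holds for the down-set coordinates of `u`. [this work] -/
theorem pcrit_of_aFree {lam g : ℝ} (hlam : 3 / 2 ≤ lam) (hg : 0 ≤ g) (hg1 : g ≤ 1) (u : Sym2 V → unitInterval)
    (hd : s ≠ a ∧ s ≠ b ∧ s ≠ c ∧ a ≠ b ∧ a ≠ c ∧ b ≠ c) (ha : ∀ x : V, x ≠ a → (u s(a, x) : ℝ) = 0) :
    Crit[lam; g;
      (prodBernoulli u).real ((openConn s a)ᶜ ∩ (openConn s b)ᶜ ∩ (openConn s c)ᶜ ∩ (openConn a b)ᶜ ∩ (openConn a c)ᶜ ∩ (openConn b c)ᶜ :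
        Set (BondConfig V)),
      (prodBernoulli u).real ((openConn s b)ᶜ ∩ (openConn s c)ᶜ ∩ (openConn a b)ᶜ ∩ (openConn a c)ᶜ : Set (BondConfig V)),
      (prodBernoulli u).real ((openConn s b)ᶜ ∩ (openConn a b)ᶜ ∩ (openConn b c)ᶜ : Set (BondConfig V)),
      (prodBernoulli u).real ((openConn c s)ᶜ ∩ (openConn c a)ᶜ ∩ (openConn c b)ᶜ : Set (BondConfig V))] := by
  -- `a` is a.s. isolated: the four coordinates are the 3-point isolation coordinates of `(s, b; c)`
  have hae : ∀ᵐ ω ∂(prodBernoulli u), (¬ (openGraph ω).Reachable a s ∧ ¬ (openGraph ω).Reachable s a) ∧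
      (¬ (openGraph ω).Reachable a b ∧ ¬ (openGraph ω).Reachable b a) ∧ (¬ (openGraph ω).Reachable a c ∧ ¬ (openGraph ω).Reachable c a) := by
    filter_upwards [ae_sep_of_isolated u ha hd.1, ae_sep_of_isolated u ha hd.2.2.2.1.symm, ae_sep_of_isolated u ha hd.2.2.2.2.1.symm]
      with ω h1 h2 h3
    exact ⟨h1, h2, h3⟩
  have Y : ∀ (X Z : Set (BondConfig V)), (∀ ω : BondConfig V, ((¬ (openGraph ω).Reachable a s ∧ ¬ (openGraph ω).Reachable s a) ∧
      (¬ (openGraph ω).Reachable a b ∧ ¬ (openGraph ω).Reachable b a) ∧ (¬ (openGraph ω).Reachable a c ∧ ¬ (openGraph ω).Reachable c a)) →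
      (ω ∈ X ↔ ω ∈ Z)) → (prodBernoulli u).real X = (prodBernoulli u).real Z := fun X Z hX =>
    real_congr_of_ae u (by filter_upwards [hae] with ω hω; exact hX ω hω)
  have hcs : ∀ ω : BondConfig V, (openGraph ω).Reachable c s ↔ (openGraph ω).Reachable s c := fun ω => ⟨fun h => h.symm, fun h => h.symm⟩
  have hcb : ∀ ω : BondConfig V, (openGraph ω).Reachable c b ↔ (openGraph ω).Reachable b c := fun ω => ⟨fun h => h.symm, fun h => h.symm⟩
  have e0 : (prodBernoulli u).real ((openConn s a)ᶜ ∩ (openConn s b)ᶜ ∩ (openConn s c)ᶜ ∩ (openConn a b)ᶜ ∩ (openConn a c)ᶜ ∩ (openConn b c)ᶜ :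
      Set (BondConfig V)) = (prodBernoulli u).real ((openConn s b)ᶜ ∩ (openConn s c)ᶜ ∩ (openConn b c)ᶜ : Set (BondConfig V)) :=
    Y _ _ fun ω hω => by simp only [mem_inter_iff, mem_compl_iff, openConn, mem_setOf_eq]; tauto
  have e2 : (prodBernoulli u).real ((openConn s b)ᶜ ∩ (openConn s c)ᶜ ∩ (openConn a b)ᶜ ∩ (openConn a c)ᶜ : Set (BondConfig V)) =
      (prodBernoulli u).real ((openConn s b)ᶜ ∩ (openConn s c)ᶜ : Set (BondConfig V)) :=
    Y _ _ fun ω hω => by simp only [mem_inter_iff, mem_compl_iff, openConn, mem_setOf_eq]; tauto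
  have e4 : (prodBernoulli u).real ((openConn s b)ᶜ ∩ (openConn a b)ᶜ ∩ (openConn b c)ᶜ : Set (BondConfig V)) =
      (prodBernoulli u).real ((openConn s b)ᶜ ∩ (openConn b c)ᶜ : Set (BondConfig V)) :=
    Y _ _ fun ω hω => by simp only [mem_inter_iff, mem_compl_iff, openConn, mem_setOf_eq]; tauto
  have e7 : (prodBernoulli u).real ((openConn c s)ᶜ ∩ (openConn c a)ᶜ ∩ (openConn c b)ᶜ : Set (BondConfig V)) =
      (prodBernoulli u).real ((openConn s c)ᶜ ∩ (openConn b c)ᶜ : Set (BondConfig V)) :=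
    Y _ _ fun ω hω => by simp only [mem_inter_iff, mem_compl_iff, openConn, mem_setOf_eq, hcs ω, hcb ω]; tauto
  have he71 : (prodBernoulli u).real ((openConn c s)ᶜ ∩ (openConn c a)ᶜ ∩ (openConn c b)ᶜ : Set (BondConfig V)) ≤ 1 := measureReal_le_one
  have h02 : (prodBernoulli u).real ((openConn s a)ᶜ ∩ (openConn s b)ᶜ ∩ (openConn s c)ᶜ ∩ (openConn a b)ᶜ ∩ (openConn a c)ᶜ ∩ (openConn b c)ᶜ :
      Set (BondConfig V)) ≤ (prodBernoulli u).real ((openConn s b)ᶜ ∩ (openConn s c)ᶜ ∩ (openConn a b)ᶜ ∩ (openConn a c)ᶜ : Set (BondConfig V)) :=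
    measureReal_mono (fun ω hω => ⟨⟨⟨hω.1.1.1.1.2, hω.1.1.1.2⟩, hω.1.1.2⟩, hω.1.2⟩)
  have h04 : (prodBernoulli u).real ((openConn s a)ᶜ ∩ (openConn s b)ᶜ ∩ (openConn s c)ᶜ ∩ (openConn a b)ᶜ ∩ (openConn a c)ᶜ ∩ (openConn b c)ᶜ :
      Set (BondConfig V)) ≤ (prodBernoulli u).real ((openConn s b)ᶜ ∩ (openConn a b)ᶜ ∩ (openConn b c)ᶜ : Set (BondConfig V)) :=
    measureReal_mono (fun ω hω => ⟨⟨hω.1.1.1.1.2, hω.1.1.2⟩, hω.2⟩)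
  refine crit_of_afOne hg hg1 he71 h02 h04 ?_
  rw [e0, e2, e4, e7]
  exact afOne_lam_graph hlam u s b c hg

/-- **The gluing criterion holds for every `s`-free piece.**  If the pairs of `u` avoid `s`, then for every `λ ≥ 3/2` and `γ ∈ [0,1]` the criterion
`C(γ)` holds for the down-set coordinates of `u` (the 3-point law of `(a, b; c)`). [this work] -/
theorem pcrit_of_sFree {lam g : ℝ} (hlam : 3 / 2 ≤ lam) (hg : 0 ≤ g) (hg1 : g ≤ 1) (u : Sym2 V → unitInterval)
    (hd : s ≠ a ∧ s ≠ b ∧ s ≠ c ∧ a ≠ b ∧ a ≠ c ∧ b ≠ c) (hs : ∀ x : V, x ≠ s → (u s(s, x) : ℝ) = 0) :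
    Crit[lam; g;
      (prodBernoulli u).real ((openConn s a)ᶜ ∩ (openConn s b)ᶜ ∩ (openConn s c)ᶜ ∩ (openConn a b)ᶜ ∩ (openConn a c)ᶜ ∩ (openConn b c)ᶜ :
        Set (BondConfig V)),
      (prodBernoulli u).real ((openConn s b)ᶜ ∩ (openConn s c)ᶜ ∩ (openConn a b)ᶜ ∩ (openConn a c)ᶜ : Set (BondConfig V)),
      (prodBernoulli u).real ((openConn s b)ᶜ ∩ (openConn a b)ᶜ ∩ (openConn b c)ᶜ : Set (BondConfig V)),
      (prodBernoulli u).real ((openConn c s)ᶜ ∩ (openConn c a)ᶜ ∩ (openConn c b)ᶜ : Set (BondConfig V))] := by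
  have hae : ∀ᵐ ω ∂(prodBernoulli u), (¬ (openGraph ω).Reachable s a ∧ ¬ (openGraph ω).Reachable a s) ∧
      (¬ (openGraph ω).Reachable s b ∧ ¬ (openGraph ω).Reachable b s) ∧ (¬ (openGraph ω).Reachable s c ∧ ¬ (openGraph ω).Reachable c s) := by
    filter_upwards [ae_sep_of_isolated u hs hd.1.symm, ae_sep_of_isolated u hs hd.2.1.symm, ae_sep_of_isolated u hs hd.2.2.1.symm]
      with ω h1 h2 h3
    exact ⟨h1, h2, h3⟩
  have Y : ∀ (X Z : Set (BondConfig V)), (∀ ω : BondConfig V, ((¬ (openGraph ω).Reachable s a ∧ ¬ (openGraph ω).Reachable a s) ∧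
      (¬ (openGraph ω).Reachable s b ∧ ¬ (openGraph ω).Reachable b s) ∧ (¬ (openGraph ω).Reachable s c ∧ ¬ (openGraph ω).Reachable c s)) →
      (ω ∈ X ↔ ω ∈ Z)) → (prodBernoulli u).real X = (prodBernoulli u).real Z := fun X Z hX =>
    real_congr_of_ae u (by filter_upwards [hae] with ω hω; exact hX ω hω)
  have hca : ∀ ω : BondConfig V, (openGraph ω).Reachable c a ↔ (openGraph ω).Reachable a c := fun ω => ⟨fun h => h.symm, fun h => h.symm⟩
  have hcb : ∀ ω : BondConfig V, (openGraph ω).Reachable c b ↔ (openGraph ω).Reachable b c := fun ω => ⟨fun h => h.symm, fun h => h.symm⟩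
  have e0 : (prodBernoulli u).real ((openConn s a)ᶜ ∩ (openConn s b)ᶜ ∩ (openConn s c)ᶜ ∩ (openConn a b)ᶜ ∩ (openConn a c)ᶜ ∩ (openConn b c)ᶜ :
      Set (BondConfig V)) = (prodBernoulli u).real ((openConn a b)ᶜ ∩ (openConn a c)ᶜ ∩ (openConn b c)ᶜ : Set (BondConfig V)) :=
    Y _ _ fun ω hω => by simp only [mem_inter_iff, mem_compl_iff, openConn, mem_setOf_eq]; tauto
  have e2 : (prodBernoulli u).real ((openConn s b)ᶜ ∩ (openConn s c)ᶜ ∩ (openConn a b)ᶜ ∩ (openConn a c)ᶜ : Set (BondConfig V)) =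
      (prodBernoulli u).real ((openConn a b)ᶜ ∩ (openConn a c)ᶜ : Set (BondConfig V)) :=
    Y _ _ fun ω hω => by simp only [mem_inter_iff, mem_compl_iff, openConn, mem_setOf_eq]; tauto
  have e4 : (prodBernoulli u).real ((openConn s b)ᶜ ∩ (openConn a b)ᶜ ∩ (openConn b c)ᶜ : Set (BondConfig V)) =
      (prodBernoulli u).real ((openConn a b)ᶜ ∩ (openConn b c)ᶜ : Set (BondConfig V)) :=
    Y _ _ fun ω hω => by simp only [mem_inter_iff, mem_compl_iff, openConn, mem_setOf_eq]; tauto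
  have e7 : (prodBernoulli u).real ((openConn c s)ᶜ ∩ (openConn c a)ᶜ ∩ (openConn c b)ᶜ : Set (BondConfig V)) =
      (prodBernoulli u).real ((openConn a c)ᶜ ∩ (openConn b c)ᶜ : Set (BondConfig V)) :=
    Y _ _ fun ω hω => by simp only [mem_inter_iff, mem_compl_iff, openConn, mem_setOf_eq, hca ω, hcb ω]; tauto
  have he71 : (prodBernoulli u).real ((openConn c s)ᶜ ∩ (openConn c a)ᶜ ∩ (openConn c b)ᶜ : Set (BondConfig V)) ≤ 1 := measureReal_le_one
  have h02 : (prodBernoulli u).real ((openConn s a)ᶜ ∩ (openConn s b)ᶜ ∩ (openConn s c)ᶜ ∩ (openConn a b)ᶜ ∩ (openConn a c)ᶜ ∩ (openConn b c)ᶜ :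
      Set (BondConfig V)) ≤ (prodBernoulli u).real ((openConn s b)ᶜ ∩ (openConn s c)ᶜ ∩ (openConn a b)ᶜ ∩ (openConn a c)ᶜ : Set (BondConfig V)) :=
    measureReal_mono (fun ω hω => ⟨⟨⟨hω.1.1.1.1.2, hω.1.1.1.2⟩, hω.1.1.2⟩, hω.1.2⟩)
  have h04 : (prodBernoulli u).real ((openConn s a)ᶜ ∩ (openConn s b)ᶜ ∩ (openConn s c)ᶜ ∩ (openConn a b)ᶜ ∩ (openConn a c)ᶜ ∩ (openConn b c)ᶜ :
      Set (BondConfig V)) ≤ (prodBernoulli u).real ((openConn s b)ᶜ ∩ (openConn a b)ᶜ ∩ (openConn b c)ᶜ : Set (BondConfig V)) :=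
    measureReal_mono (fun ω hω => ⟨⟨hω.1.1.1.1.2, hω.1.1.2⟩, hω.2⟩)
  refine crit_of_afOne hg hg1 he71 h02 h04 ?_
  rw [e0, e2, e4, e7]
  exact afOne_lam_graph hlam u a b c hg

/-- **`AF¹_λ` of the `s–a`-glued view holds for every weight** (all `λ ≥ 3/2`, `γ ≥ 0`), in down-set coordinates `(d1, d2, d4, d7)` of `…SuperTerminalDownsets`:
`AFone[λ; γ; d2+d4−d1, d4−d1, d2−d1, 1−d7]` — `afOne_lam_graph` for the weight with the pair `s(s,a)` made sure, transported by the sure-pair lemmas exactly as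
`SuperTerminalDownsets.sextic_law`.  (This is the graph-level input of the cell-algebra stability programme for the sharp row, memo §7: the needed hypothesis on a
FULL piece is `AF¹(γ_other)` of its glued view.) [this work] -/
theorem afOne_glued_of_weight {lam : ℝ} (hlam : 3 / 2 ≤ lam) (u : Sym2 V → unitInterval)
    (hd : s ≠ a ∧ s ≠ b ∧ s ≠ c ∧ a ≠ b ∧ a ≠ c ∧ b ≠ c) {g : ℝ} (hg : 0 ≤ g) :
    AFone[lam; g;
      (prodBernoulli u).real ((openConn s b)ᶜ ∩ (openConn s c)ᶜ ∩ (openConn a b)ᶜ ∩ (openConn a c)ᶜ : Set (BondConfig V)) +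
        (prodBernoulli u).real ((openConn s b)ᶜ ∩ (openConn a b)ᶜ ∩ (openConn b c)ᶜ : Set (BondConfig V)) -
        (prodBernoulli u).real ((openConn s b)ᶜ ∩ (openConn s c)ᶜ ∩ (openConn a b)ᶜ ∩ (openConn a c)ᶜ ∩ (openConn b c)ᶜ : Set (BondConfig V)),
      (prodBernoulli u).real ((openConn s b)ᶜ ∩ (openConn a b)ᶜ ∩ (openConn b c)ᶜ : Set (BondConfig V)) -
        (prodBernoulli u).real ((openConn s b)ᶜ ∩ (openConn s c)ᶜ ∩ (openConn a b)ᶜ ∩ (openConn a c)ᶜ ∩ (openConn b c)ᶜ : Set (BondConfig V)),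
      (prodBernoulli u).real ((openConn s b)ᶜ ∩ (openConn s c)ᶜ ∩ (openConn a b)ᶜ ∩ (openConn a c)ᶜ : Set (BondConfig V)) -
        (prodBernoulli u).real ((openConn s b)ᶜ ∩ (openConn s c)ᶜ ∩ (openConn a b)ᶜ ∩ (openConn a c)ᶜ ∩ (openConn b c)ᶜ : Set (BondConfig V)),
      1 - (prodBernoulli u).real ((openConn c s)ᶜ ∩ (openConn c a)ᶜ ∩ (openConn c b)ᶜ : Set (BondConfig V))] := by
  have h := afOne_lam_graph hlam (Function.update u s(s, a) 1) s b c hg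
  have hs : s ∈ ({s, b, c} : Finset V) := Finset.mem_insert_self _ _
  have hT : insert a ({s, b, c} : Finset V) = {s, a, b, c} := Finset.insert_comm a s {b, c}
  have e1 : (prodBernoulli (Function.update u s(s, a) 1)).real ((openConn s b)ᶜ ∩ (openConn s c)ᶜ ∩ (openConn b c)ᶜ) =
      (prodBernoulli u).real ((openConn s b)ᶜ ∩ (openConn s c)ᶜ ∩ (openConn a b)ᶜ ∩ (openConn a c)ᶜ ∩ (openConn b c)ᶜ) := by
    conv_lhs => rw [← partLE3_blk1 hd]
    rw [real_partLE_update_one u hs (by simp [hd.2.1, hd.2.2.1, hd.2.2.2.1, hd.2.2.2.2.1]), hT, partLE_blk1 hd]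
  have e2 : (prodBernoulli (Function.update u s(s, a) 1)).real ((openConn s b)ᶜ ∩ (openConn s c)ᶜ) =
      (prodBernoulli u).real ((openConn s b)ᶜ ∩ (openConn s c)ᶜ ∩ (openConn a b)ᶜ ∩ (openConn a c)ᶜ) := by
    conv_lhs => rw [← partLE3_blk2 hd]
    rw [real_partLE_update_one u hs (by simp [hd.2.1, hd.2.2.1, hd.2.2.2.1, hd.2.2.2.2.1]), hT, partLE_blk2 hd]
  have e4 : (prodBernoulli (Function.update u s(s, a) 1)).real ((openConn s b)ᶜ ∩ (openConn b c)ᶜ) =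
      (prodBernoulli u).real ((openConn s b)ᶜ ∩ (openConn a b)ᶜ ∩ (openConn b c)ᶜ) := by
    conv_lhs => rw [← partLE3_blk4 hd]
    rw [real_partLE_update_one u hs (by simp [hd.2.1, hd.2.2.2.1]), hT, partLE_blk4 hd]
  have e7 : (prodBernoulli (Function.update u s(s, a) 1)).real ((openConn s c)ᶜ ∩ (openConn b c)ᶜ) =
      (prodBernoulli u).real ((openConn c s)ᶜ ∩ (openConn c a)ᶜ ∩ (openConn c b)ᶜ) := by
    conv_lhs => rw [← partLE3_blk7 hd]
    rw [real_partLE_update_one u hs (by simp [hd.2.2.1, hd.2.2.2.2.1]), hT, partLE_blk7 hd]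
  rw [e1, e2, e4, e7] at h
  exact h

/-! ## The unconditional assembly -/

/-- **MAIN THEOREM: for `λ ≥ 3/2`, every `{s,a,b,c}`-piece that misses the port `c`, or misses `b`, or misses `s`, or misses `a`, is irrelevant to
`P3_λ`.**  Let `s a b c` be pairwise distinct, `part : V → ι` a splitting of `w` along `{s,a,b,c}`, and `J` a set of labels such that every piece
`i ∉ J` misses one of `c, b, s, a`.  If the partial union `w_J := w·1_{terminal pairs ∪ pieces of J}` satisfies the row `P3_λ`, so does `w`.
(`p3lam_of_portPieces₄` with its criterion hypotheses discharged by `pcrit_of_aFree` / `pcrit_of_sFree`.) [this work] -/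
theorem p3lam_of_portPieces₅ {ι : Type*} [Fintype ι] {lam : ℝ} (hlam : 3 / 2 ≤ lam) (w : Sym2 V → unitInterval)
    (hd : s ≠ a ∧ s ≠ b ∧ s ≠ c ∧ a ≠ b ∧ a ≠ c ∧ b ≠ c) (part : V → ι)
    (hw : ∀ x y : V, x ∉ ({s, a, b, c} : Finset V) → y ∉ ({s, a, b, c} : Finset V) → part x ≠ part y → (w s(x, y) : ℝ) = 0)
    (J : Finset ι) (hJ : ∀ i, i ∉ J → ∃ t ∈ ({s, a, b, c} : Finset V),
      ∀ v : V, v ∉ ({s, a, b, c} : Finset V) → part v = i → (w s(t, v) : ℝ) = 0)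
    (hrow :
      (prodBernoulli fun e => if e ∈ ({s, a, b, c} : Finset V).sym2 ∨ ∃ i ∈ J, e ∈ piecePairs {s, a, b, c} part i then w e else 0).real
          (openConn s a ∩ (openConn s b)ᶜ : Set (BondConfig V)) *
        (prodBernoulli fun e => if e ∈ ({s, a, b, c} : Finset V).sym2 ∨ ∃ i ∈ J, e ∈ piecePairs {s, a, b, c} part i then w e else 0).real
          ((openConn c s)ᶜ ∩ (openConn c a)ᶜ ∩ (openConn c b)ᶜ : Set (BondConfig V))ᶜ ≤
      lam * (prodBernoulli fun e => if e ∈ ({s, a, b, c} : Finset V).sym2 ∨ ∃ i ∈ J, e ∈ piecePairs {s, a, b, c} part i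
          then w e else 0).real
          (openConn s a ∩ (openConn s b)ᶜ ∩ ((openConn c s)ᶜ ∩ (openConn c a)ᶜ ∩ (openConn c b)ᶜ)ᶜ : Set (BondConfig V))) :
    (prodBernoulli w).real (openConn s a ∩ (openConn s b)ᶜ : Set (BondConfig V)) *
        (prodBernoulli w).real ((openConn c s)ᶜ ∩ (openConn c a)ᶜ ∩ (openConn c b)ᶜ : Set (BondConfig V))ᶜ ≤
      lam * (prodBernoulli w).real (openConn s a ∩ (openConn s b)ᶜ ∩ ((openConn c s)ᶜ ∩ (openConn c a)ᶜ ∩ (openConn c b)ᶜ)ᶜ : Set (BondConfig V)) := by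
  set wp : ι → Sym2 V → unitInterval := fun i e => if e ∈ piecePairs {s, a, b, c} part i then w e else 0 with hwp
  -- transfer of 'the pairs of piece `i` at terminal `t` vanish' to the piece weight `wᵢ`
  have htr : ∀ (i : ι) (t : V), t ∈ ({s, a, b, c} : Finset V) →
      (∀ v : V, v ∉ ({s, a, b, c} : Finset V) → part v = i → (w s(t, v) : ℝ) = 0) →
      ∀ x : V, x ≠ t → ((wp i) s(t, x) : ℝ) = 0 := by
    intro i t ht hzero x hx
    by_cases hmem : s(t, x) ∈ piecePairs ({s, a, b, c} : Finset V) part i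
    · obtain ⟨u, v, ⟨hu, hui⟩, -, -, he⟩ := mem_piecePairs.1 hmem
      rcases Sym2.eq_iff.1 he with ⟨h1, -⟩ | ⟨-, h2⟩
      · exact absurd (h1 ▸ ht) hu
      · have hxT : x ∉ ({s, a, b, c} : Finset V) := h2 ▸ hu
        have hpx : part x = i := by rw [h2, hui]
        have h0 := hzero x hxT hpx
        simp only [hwp, if_pos hmem]
        exact h0
    · simp only [hwp, if_neg hmem]
      rfl
  have hsT : s ∈ ({s, a, b, c} : Finset V) := by simp
  have haT : a ∈ ({s, a, b, c} : Finset V) := by simp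
  have hbT : b ∈ ({s, a, b, c} : Finset V) := by simp
  have hcT : c ∈ ({s, a, b, c} : Finset V) := by simp
  refine SuperTerminalP3LamPortPiecesFour.p3lam_of_portPieces₄ hlam w hd part hw J (fun i hi => ?_) hrow
  obtain ⟨t, ht, hzero⟩ := hJ i hi
  have ht' : t = s ∨ t = a ∨ t = b ∨ t = c := by simpa using ht
  rcases ht' with h | h | h | h <;> subst h
  · -- misses `s`: kind 5
    exact Or.inr (Or.inr (Or.inr (Or.inr ⟨hzero, fun g hg0 hg1 => pcrit_of_sFree hlam hg0 hg1 (wp i) hd (htr i _ hsT hzero)⟩)))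
  · -- misses `a`: kind 4
    exact Or.inr (Or.inr (Or.inr (Or.inl ⟨hzero, fun g hg0 hg1 => pcrit_of_aFree hlam hg0 hg1 (wp i) hd (htr i _ haT hzero)⟩)))
  · -- misses `b`: kind 2
    exact Or.inr (Or.inl hzero)
  · -- misses `c`: kind 1
    exact Or.inl hzero

end Pieces

end Summit.CriticalPhenomena.PercolationContinuityZ3.Theorems.SuperTerminalP3LamPortPiecesFive
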